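import Mathlib
import HarnessLib

/-!
# Newman's entire function on the real axis: growth points

For Newman's function `N(z) = ∫_ℝ exp(z eᵗ - t eᵗ + t) dt` (D. J. Newman, *An entire function
bounded in every direction*, Amer. Math. Monthly 83 (1976) 192–193) we prove the real-axis facts
that feed the stretched-vortex-row potential flow:

* the real integrand `t ↦ exp (a eᵗ - t eᵗ + t)` is dominated by `exp (e^{a+1}) · min (eᵗ, e⁻ᵗ)`,
  hence integrable, and on the real axis `N x = ∫ exp (x eᵗ - t eᵗ + t) dt` is real, monotone in
  `x`, strictly larger at `1` than at `0` (so `N 0 ≠ N 1`), bounded below by `e^{x-3}` for `x ≥ 0`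
  (restrict to `t ∈ [0, 1]`), and `‖N z‖ ≤ ∫ exp (Re z · eᵗ - t eᵗ + t) dt` for every complex `z`;
* consequently, with `k = 2π/L` and `w = exp (-i k (x + i y))`, the quotient
  `E_c(w) = (N (c + w) - N c) w⁻¹` is bounded at `x = L/2` (`w = -e^{ky}`) for `y ≥ 0`, and for
  `Im c = 4` it is as large as desired at `k x = arcsin (4 e^{-ky})`, where `c + w` is real and of
  size `≍ e^{ky}`.

All statements are elementary real analysis (`Real.add_one_le_exp`, monotonicity of the Bochner
integral, `exp v / v → ∞`).
-/

set_option linter.dupNamespace false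

noncomputable section

open scoped Topology ENNReal Real
open Filter Set Function MeasureTheory Complex

namespace Summit.AnomalousDissipation.AnomalousDissipation.Theorems
namespace MarginalStabilityChainStretchedVortexRows
namespace PotentialFlow

/-- Two-sided exponential domination of the real Newman integrand:
`exp (a eᵗ - t eᵗ + t) ≤ exp (e^{a+1}) eᵗ` and `≤ exp (e^{a+1}) e⁻ᵗ`, from `1 + v ≤ eᵛ`.
[folklore] -/
theorem newmanGrowth_integrand_le (a τ : ℝ) :
    Real.exp (a * Real.exp τ - τ * Real.exp τ + τ) ≤ Real.exp (Real.exp (a + 1)) * Real.exp τ ∧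
    Real.exp (a * Real.exp τ - τ * Real.exp τ + τ) ≤
      Real.exp (Real.exp (a + 1)) * Real.exp (-τ) := by
  have hτ := Real.add_one_le_exp τ
  have he : 0 < Real.exp τ := Real.exp_pos τ
  have h1 : a + 2 - τ ≤ Real.exp (a + 1 - τ) := by linarith [Real.add_one_le_exp (a + 1 - τ)]
  have h2 : (a + 2 - τ) * Real.exp τ ≤ Real.exp (a + 1) :=
    calc (a + 2 - τ) * Real.exp τ ≤ Real.exp (a + 1 - τ) * Real.exp τ :=
          mul_le_mul_of_nonneg_right h1 he.le
      _ = Real.exp (a + 1) := by rw [← Real.exp_add]; congr 1; ring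
  constructor
  · rw [← Real.exp_add]
    exact Real.exp_le_exp.2 (by linarith)
  · rw [← Real.exp_add]
    exact Real.exp_le_exp.2 (by linarith)

/-- The real Newman integrand `t ↦ exp (a eᵗ - t eᵗ + t)` is integrable on `ℝ`. [folklore] -/
theorem newmanGrowth_integrable (a : ℝ) :
    Integrable (fun τ : ℝ => Real.exp (a * Real.exp τ - τ * Real.exp τ + τ)) := by
  have hcont : Continuous (fun τ : ℝ => Real.exp (a * Real.exp τ - τ * Real.exp τ + τ)) := by
    fun_prop
  have hIic : IntegrableOn (fun τ : ℝ => Real.exp (a * Real.exp τ - τ * Real.exp τ + τ))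
      (Iic 0) := by
    refine Integrable.mono' ((integrableOn_exp_Iic 0).const_mul (Real.exp (Real.exp (a + 1))))
      hcont.aestronglyMeasurable (Eventually.of_forall fun τ => ?_)
    rw [Real.norm_eq_abs, abs_of_pos (Real.exp_pos _)]
    exact (newmanGrowth_integrand_le a τ).1
  have hIoi : IntegrableOn (fun τ : ℝ => Real.exp (a * Real.exp τ - τ * Real.exp τ + τ))
      (Ioi 0) := by
    refine Integrable.mono'
      ((integrableOn_exp_neg_Ioi 0).const_mul (Real.exp (Real.exp (a + 1))))
      hcont.aestronglyMeasurable (Eventually.of_forall fun τ => ?_)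
    rw [Real.norm_eq_abs, abs_of_pos (Real.exp_pos _)]
    exact (newmanGrowth_integrand_le a τ).2
  have h := hIic.union hIoi
  rwa [Iic_union_Ioi, integrableOn_univ] at h

/-- On the real axis Newman's function is the real integral `∫ exp (x eᵗ - t eᵗ + t) dt`.
[folklore] -/
theorem newmanGrowth_ofReal (N : ℂ → ℂ)
    (hN : ∀ z : ℂ, N z = ∫ τ : ℝ,
      Complex.exp (z * Complex.exp (τ : ℂ) - (τ : ℂ) * Complex.exp (τ : ℂ) + (τ : ℂ))) (x : ℝ) :
    N x = ((∫ τ : ℝ, Real.exp (x * Real.exp τ - τ * Real.exp τ + τ) : ℝ) : ℂ) := by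
  rw [hN, ← integral_complex_ofReal]
  refine integral_congr_ae (Eventually.of_forall fun τ => ?_)
  simp only [Complex.ofReal_exp, Complex.ofReal_add, Complex.ofReal_sub, Complex.ofReal_mul]

/-- `‖N z‖ ≤ ∫ exp (Re z · eᵗ - t eᵗ + t) dt`: the modulus of the kernel only sees `Re z`.
[folklore] -/
theorem newmanGrowth_norm_le (N : ℂ → ℂ)
    (hN : ∀ z : ℂ, N z = ∫ τ : ℝ,
      Complex.exp (z * Complex.exp (τ : ℂ) - (τ : ℂ) * Complex.exp (τ : ℂ) + (τ : ℂ))) (z : ℂ) :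
    ‖N z‖ ≤ ∫ τ : ℝ, Real.exp (z.re * Real.exp τ - τ * Real.exp τ + τ) := by
  rw [hN]
  refine norm_integral_le_of_norm_le (newmanGrowth_integrable z.re)
    (Eventually.of_forall fun τ => ?_)
  rw [Complex.norm_exp]
  apply le_of_eq
  congr 1
  simp [Complex.exp_ofReal_re]

/-- The real integral `a ↦ ∫ exp (a eᵗ - t eᵗ + t) dt` is monotone. [folklore] -/
theorem newmanGrowth_integral_mono {a b : ℝ} (hab : a ≤ b) :
    (∫ τ : ℝ, Real.exp (a * Real.exp τ - τ * Real.exp τ + τ)) ≤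
      ∫ τ : ℝ, Real.exp (b * Real.exp τ - τ * Real.exp τ + τ) := by
  refine integral_mono (newmanGrowth_integrable a) (newmanGrowth_integrable b) (fun τ => ?_)
  exact Real.exp_le_exp.2 (by linarith [mul_le_mul_of_nonneg_right hab (Real.exp_pos τ).le])

/-- `∫ exp (-t eᵗ + t) dt < ∫ exp (eᵗ - t eᵗ + t) dt` (the difference of the integrands is a
positive function, whose support is all of `ℝ`). [folklore] -/
theorem newmanGrowth_integral_zero_lt_one :
    (∫ τ : ℝ, Real.exp (0 * Real.exp τ - τ * Real.exp τ + τ)) <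
      ∫ τ : ℝ, Real.exp (1 * Real.exp τ - τ * Real.exp τ + τ) := by
  have hlt : ∀ τ : ℝ, Real.exp (0 * Real.exp τ - τ * Real.exp τ + τ) <
      Real.exp (1 * Real.exp τ - τ * Real.exp τ + τ) := fun τ =>
    Real.exp_lt_exp.2 (by linarith [Real.exp_pos τ])
  have hsupp : (Function.support fun τ : ℝ => Real.exp (1 * Real.exp τ - τ * Real.exp τ + τ) -
      Real.exp (0 * Real.exp τ - τ * Real.exp τ + τ)) = univ :=
    Set.eq_univ_of_forall fun τ => Function.mem_support.2 (sub_pos.2 (hlt τ)).ne'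
  rw [← sub_pos, ← integral_sub (newmanGrowth_integrable 1) (newmanGrowth_integrable 0),
    integral_pos_iff_support_of_nonneg]
  · rw [hsupp, Real.volume_univ]
    exact ENNReal.zero_lt_top
  · exact fun τ => sub_nonneg.2 (hlt τ).le
  · exact (newmanGrowth_integrable 1).sub' (newmanGrowth_integrable 0)

/-- Growth on the positive real axis: `e^{T-3} ≤ ∫ exp (T eᵗ - t eᵗ + t) dt` for `T ≥ 0`
(restrict to `t ∈ [0, 1]`, where the exponent is at least `T - 3` because `e < 3`). [folklore] -/
theorem newmanGrowth_exp_le_integral {T : ℝ} (hT : 0 ≤ T) :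
    Real.exp (T - 3) ≤ ∫ τ : ℝ, Real.exp (T * Real.exp τ - τ * Real.exp τ + τ) := by
  have hpt : ∀ τ ∈ Icc (0 : ℝ) 1,
      Real.exp (T - 3) ≤ Real.exp (T * Real.exp τ - τ * Real.exp τ + τ) := by
    intro τ hτ
    apply Real.exp_le_exp.2
    have h1 : 1 ≤ Real.exp τ := Real.one_le_exp hτ.1
    have h2 : Real.exp τ ≤ Real.exp 1 := Real.exp_le_exp.2 hτ.2
    have h3 : Real.exp 1 < 3 := Real.exp_one_lt_three
    linarith [mul_nonneg hT (sub_nonneg.2 h1), hτ.1,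
      mul_nonneg (sub_nonneg.2 hτ.2) (Real.exp_pos τ).le]
  have hvol : volume (Icc (0 : ℝ) 1) ≠ ∞ := by
    rw [Real.volume_Icc]; exact ENNReal.ofReal_ne_top
  calc Real.exp (T - 3) = ∫ _ in Icc (0 : ℝ) 1, Real.exp (T - 3) := by
        rw [setIntegral_const, Real.volume_real_Icc_of_le zero_le_one]; simp
    _ ≤ ∫ τ in Icc (0 : ℝ) 1, Real.exp (T * Real.exp τ - τ * Real.exp τ + τ) :=
        setIntegral_mono_on (integrableOn_const hvol) (newmanGrowth_integrable T).integrableOn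
          measurableSet_Icc hpt
    _ ≤ ∫ τ, Real.exp (T * Real.exp τ - τ * Real.exp τ + τ) :=
        setIntegral_le_integral (newmanGrowth_integrable T)
          (Eventually.of_forall fun τ => (Real.exp_pos _).le)

/-- Real and imaginary parts of `k (x + i y) i = -k y + i k x`. [folklore] -/
theorem newmanGrowth_rot_re_im (k x y : ℝ) :
    ((k : ℂ) * ((x : ℂ) + (y : ℂ) * I) * I).re = -(k * y) ∧
    ((k : ℂ) * ((x : ℂ) + (y : ℂ) * I) * I).im = k * x := by
  constructor <;> simp

/-- `‖exp (k (x + iy) i)‖ = e^{-ky}`. [folklore] -/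
theorem newmanGrowth_norm_exp_rot (k x y : ℝ) :
    ‖Complex.exp ((k : ℂ) * ((x : ℂ) + (y : ℂ) * I) * I)‖ = Real.exp (-(k * y)) := by
  rw [Complex.norm_exp, (newmanGrowth_rot_re_im k x y).1]

/-- `exp (-(k (x + iy) i)) = e^{ky} (cos (kx) - i sin (kx))`: real and imaginary parts.
[folklore] -/
theorem newmanGrowth_exp_neg_rot_re_im (k x y : ℝ) :
    (Complex.exp (-((k : ℂ) * ((x : ℂ) + (y : ℂ) * I) * I))).re =
        Real.exp (k * y) * Real.cos (k * x) ∧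
    (Complex.exp (-((k : ℂ) * ((x : ℂ) + (y : ℂ) * I) * I))).im =
        -(Real.exp (k * y) * Real.sin (k * x)) := by
  obtain ⟨hre, him⟩ := newmanGrowth_rot_re_im k x y
  rw [Complex.exp_re, Complex.exp_im, Complex.neg_re, Complex.neg_im, hre, him, neg_neg,
    Real.cos_neg, Real.sin_neg, mul_neg]
  exact ⟨rfl, rfl⟩

/-- (i) `N 0 ≠ N 1`: `N` is real and strictly larger at `1` than at `0`. [folklore] -/
theorem newmanGrowth_zero_ne_one (N : ℂ → ℂ)
    (hN : ∀ z : ℂ, N z = ∫ τ : ℝ,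
      Complex.exp (z * Complex.exp (τ : ℂ) - (τ : ℂ) * Complex.exp (τ : ℂ) + (τ : ℂ))) :
    N 0 ≠ N 1 := by
  have h0 := newmanGrowth_ofReal N hN 0
  have h1 := newmanGrowth_ofReal N hN 1
  rw [Complex.ofReal_zero] at h0
  rw [Complex.ofReal_one] at h1
  rw [h0, h1]
  exact fun h => newmanGrowth_integral_zero_lt_one.ne (Complex.ofReal_injective h)

/-- (ii) At `x = L/2` (`w = -e^{ky}`, so `c + w` lies on the leftward horizontal ray from `c`,
where `‖N‖ ≤ ∫ exp (Re c · eᵗ - t eᵗ + t) dt`), `(N (c + w) - N c) w⁻¹` is bounded for `y ≥ 0`.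
[folklore] -/
theorem newmanGrowth_bounded (N : ℂ → ℂ)
    (hN : ∀ z : ℂ, N z = ∫ τ : ℝ,
      Complex.exp (z * Complex.exp (τ : ℂ) - (τ : ℂ) * Complex.exp (τ : ℂ) + (τ : ℂ)))
    (c : ℂ) (L : ℝ) (hL : 0 < L) :
    ∃ B : ℝ, ∀ y : ℝ, 0 ≤ y →
      ‖(N (c + Complex.exp (-(((2 * π / L : ℝ) : ℂ) * (((L / 2 : ℝ) : ℂ) + (y : ℂ) * I) * I))) -
          N c) *
        Complex.exp (((2 * π / L : ℝ) : ℂ) * (((L / 2 : ℝ) : ℂ) + (y : ℂ) * I) * I)‖ ≤ B := by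
  refine ⟨(∫ τ : ℝ, Real.exp (c.re * Real.exp τ - τ * Real.exp τ + τ)) + ‖N c‖, fun y hy => ?_⟩
  set k : ℝ := 2 * π / L with hk
  have hkpos : 0 < k := by rw [hk]; positivity
  have hkL : k * (L / 2) = π :=
    calc k * (L / 2) = π * (L / L) := by rw [hk]; ring
      _ = π := by rw [div_self hL.ne', mul_one]
  set w := Complex.exp (-((k : ℂ) * (((L / 2 : ℝ) : ℂ) + (y : ℂ) * I) * I)) with hw
  have hwre : w.re = -Real.exp (k * y) := by
    rw [hw, (newmanGrowth_exp_neg_rot_re_im k (L / 2) y).1, hkL, Real.cos_pi]; ring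
  rw [norm_mul, newmanGrowth_norm_exp_rot]
  have hNcw : ‖N (c + w)‖ ≤ ∫ τ : ℝ, Real.exp (c.re * Real.exp τ - τ * Real.exp τ + τ) := by
    refine (newmanGrowth_norm_le N hN (c + w)).trans (newmanGrowth_integral_mono ?_)
    rw [Complex.add_re, hwre]
    linarith [Real.exp_pos (k * y)]
  have h1 : ‖N (c + w) - N c‖ ≤
      (∫ τ : ℝ, Real.exp (c.re * Real.exp τ - τ * Real.exp τ + τ)) + ‖N c‖ := by
    linarith [norm_sub_le (N (c + w)) (N c)]
  have h2 : Real.exp (-(k * y)) ≤ 1 :=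
    Real.exp_le_one_iff.2 (by linarith [mul_nonneg hkpos.le hy])
  have h0 : 0 ≤ (∫ τ : ℝ, Real.exp (c.re * Real.exp τ - τ * Real.exp τ + τ)) + ‖N c‖ :=
    add_nonneg (integral_nonneg fun τ => (Real.exp_pos _).le) (norm_nonneg _)
  calc ‖N (c + w) - N c‖ * Real.exp (-(k * y))
      ≤ ((∫ τ : ℝ, Real.exp (c.re * Real.exp τ - τ * Real.exp τ + τ)) + ‖N c‖) * 1 :=
        mul_le_mul h1 h2 (Real.exp_pos _).le h0
    _ = _ := mul_one _

/-- (iii) If `Im c = 4`, then for every `M` and all large `y` there is `x ∈ (0, L/2)`, namely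
`k x = arcsin (4 e^{-ky})`, with `‖(N (c + w) - N c) w⁻¹‖ ≥ M`: there `c + w = T` is real,
`T ≥ Re c + e^{ky}/2`, and `N T ≥ e^{T-3}` while `‖w⁻¹‖ = e^{-ky}`. [folklore] -/
theorem newmanGrowth_large (N : ℂ → ℂ)
    (hN : ∀ z : ℂ, N z = ∫ τ : ℝ,
      Complex.exp (z * Complex.exp (τ : ℂ) - (τ : ℂ) * Complex.exp (τ : ℂ) + (τ : ℂ)))
    (c : ℂ) (hc : c.im = 4) (L : ℝ) (hL : 0 < L) (M : ℝ) :
    ∃ Y : ℝ, ∀ y : ℝ, Y ≤ y → ∃ x : ℝ, x ∈ Set.Ioo 0 (L / 2) ∧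
      M ≤ ‖(N (c + Complex.exp (-(((2 * π / L : ℝ) : ℂ) * ((x : ℂ) + (y : ℂ) * I) * I))) - N c) *
        Complex.exp (((2 * π / L : ℝ) : ℂ) * ((x : ℂ) + (y : ℂ) * I) * I)‖ := by
  set k : ℝ := 2 * π / L with hk
  have hkpos : 0 < k := by rw [hk]; positivity
  have hkL : k * (L / 2) = π :=
    calc k * (L / 2) = π * (L / L) := by rw [hk]; ring
      _ = π := by rw [div_self hL.ne', mul_one]
  set K : ℝ := 2 * (|M| + ‖N c‖) * Real.exp (3 - c.re) with hK
  -- eventual largeness of `u = e^{ky}` and of `exp (u/2) / (u/2)`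
  have hu : Tendsto (fun y : ℝ => Real.exp (k * y)) atTop atTop :=
    Real.tendsto_exp_atTop.comp (tendsto_id.const_mul_atTop hkpos)
  have hev1 : ∀ᶠ y in atTop, max 8 (-2 * c.re) ≤ Real.exp (k * y) := hu.eventually_ge_atTop _
  have hratio : Tendsto (fun v : ℝ => Real.exp v / v) atTop atTop := by
    simpa using Real.tendsto_exp_div_pow_atTop 1
  have hev2 : ∀ᶠ y in atTop, K ≤ Real.exp (Real.exp (k * y) / 2) / (Real.exp (k * y) / 2) :=
    (hratio.comp (hu.atTop_div_const (by norm_num : (0 : ℝ) < 2))).eventually_ge_atTop K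
  obtain ⟨Y, hY⟩ := eventually_atTop.1 (hev1.and hev2)
  refine ⟨Y, fun y hy => ?_⟩
  obtain ⟨h1, h2⟩ := hY y hy
  -- the point `x`, in terms of `u = e^{ky}` and `s = 4 / u = sin (k x)`
  set u : ℝ := Real.exp (k * y) with hu_def
  have hu8 : 8 ≤ u := (le_max_left _ _).trans h1
  have huc : -2 * c.re ≤ u := (le_max_right _ _).trans h1
  have hupos : 0 < u := Real.exp_pos _
  set s : ℝ := 4 / u with hs
  have hs0 : 0 < s := by rw [hs]; positivity
  have hs1 : s ≤ 1 / 2 := by rw [hs, div_le_iff₀ hupos]; linarith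
  have hus : u * s = 4 :=
    calc u * s = 4 * (u / u) := by rw [hs]; ring
      _ = 4 := by rw [div_self hupos.ne', mul_one]
  set x : ℝ := Real.arcsin s / k with hx
  have hkx : k * x = Real.arcsin s :=
    calc k * x = Real.arcsin s * (k / k) := by rw [hx]; ring
      _ = Real.arcsin s := by rw [div_self hkpos.ne', mul_one]
  have hsin : Real.sin (k * x) = s := by
    rw [hkx, Real.sin_arcsin (by linarith) (by linarith)]
  have hcos_ge : 1 / 2 ≤ Real.cos (k * x) := by
    rw [hkx, Real.cos_arcsin, Real.le_sqrt' (by norm_num : (0 : ℝ) < 1 / 2)]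
    nlinarith [hs0, hs1]
  refine ⟨x, ⟨div_pos (Real.arcsin_pos.2 hs0) hkpos, ?_⟩, ?_⟩
  · have hlt : k * x < k * (L / 2) := by
      rw [hkx, hkL]; linarith [Real.arcsin_le_pi_div_two s, Real.pi_pos]
    exact lt_of_mul_lt_mul_left hlt hkpos.le
  -- `c + w` is the real number `T`
  set w := Complex.exp (-((k : ℂ) * ((x : ℂ) + (y : ℂ) * I) * I)) with hw
  obtain ⟨hwre, hwim⟩ := newmanGrowth_exp_neg_rot_re_im k x y
  rw [← hw, ← hu_def] at hwre hwim
  set T : ℝ := c.re + u * Real.cos (k * x) with hT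
  have hcw : c + w = (T : ℂ) := by
    apply Complex.ext
    · rw [Complex.add_re, Complex.ofReal_re, hwre]
    · rw [Complex.add_im, Complex.ofReal_im, hwim, hsin, hus, hc]; ring
  have hT1 : c.re + u / 2 ≤ T := by
    rw [hT]; linarith [mul_le_mul_of_nonneg_left hcos_ge hupos.le]
  have hT0 : 0 ≤ T := by linarith
  -- lower bound for `‖N T - N c‖`
  have hMi : 0 ≤ ∫ τ : ℝ, Real.exp (T * Real.exp τ - τ * Real.exp τ + τ) :=
    integral_nonneg fun τ => (Real.exp_pos _).le
  have hNT : ‖N T‖ = ∫ τ : ℝ, Real.exp (T * Real.exp τ - τ * Real.exp τ + τ) := by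
    rw [newmanGrowth_ofReal N hN T, Complex.norm_of_nonneg hMi]
  have hgrowth := newmanGrowth_exp_le_integral hT0
  have hlow : Real.exp (T - 3) - ‖N c‖ ≤ ‖N T - N c‖ := by
    linarith [norm_sub_norm_le (N T) (N c)]
  have hexp : (|M| + ‖N c‖) * u ≤ Real.exp (T - 3) := by
    have h2' : K * (u / 2) ≤ Real.exp (u / 2) := by
      rwa [le_div_iff₀ (by positivity : (0 : ℝ) < u / 2)] at h2
    have hE : Real.exp (c.re - 3) * Real.exp (3 - c.re) = 1 := by
      rw [← Real.exp_add, show c.re - 3 + (3 - c.re) = 0 by ring, Real.exp_zero]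
    calc (|M| + ‖N c‖) * u
        = (|M| + ‖N c‖) * u * (Real.exp (c.re - 3) * Real.exp (3 - c.re)) := by
          rw [hE, mul_one]
      _ = Real.exp (c.re - 3) * (K * (u / 2)) := by rw [hK]; ring
      _ ≤ Real.exp (c.re - 3) * Real.exp (u / 2) :=
          mul_le_mul_of_nonneg_left h2' (Real.exp_pos _).le
      _ = Real.exp (c.re - 3 + u / 2) := (Real.exp_add _ _).symm
      _ ≤ Real.exp (T - 3) := Real.exp_le_exp.2 (by linarith)
  -- conclusion: the quantity is `‖N T - N c‖ / u`
  rw [norm_mul, newmanGrowth_norm_exp_rot, hcw, Real.exp_neg, ← hu_def, ← div_eq_mul_inv,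
    le_div_iff₀ hupos]
  have ha : M * u ≤ |M| * u := mul_le_mul_of_nonneg_right (le_abs_self M) hupos.le
  have hb : ‖N c‖ ≤ ‖N c‖ * u := le_mul_of_one_le_right (norm_nonneg _) (by linarith)
  linarith

/-- **Stub 4.** Real-axis growth and its two consequences for `E_c(w) = (N(c + w) - N(c))/w`
at `w = e^{-ik(x+iy)}`, `k = 2π/L`: (i) `N 0 ≠ N 1` (`N` is real and strictly increasing on `ℝ`);
(ii) at `x = L/2` (`w = -e^{ky}`, `c + w` on the leftward horizontal ray, where `|N| ≤ N(Re c)`)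
`E_c` is bounded for `y ≥ 0`; (iii) if `Im c = 4`, for every `M` and all large `y` there is
`x ∈ (0, L/2)` (namely `kx = arcsin(4e^{-ky})`, making `c + w = T` real, `T ≍ e^{ky}`) with
`|E_c(w)| ≥ M`, because `N(T) ≥ ∫_{[0, 1]} ≥ e^{T-3}`. [folklore] -/
theorem stub_newmanGrowthPoints (N : ℂ → ℂ)
    (hN : ∀ z : ℂ, N z = ∫ τ : ℝ,
      Complex.exp (z * Complex.exp (τ : ℂ) - (τ : ℂ) * Complex.exp (τ : ℂ) + (τ : ℂ))) :
    N 0 ≠ N 1 ∧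
    (∀ (c : ℂ) (L : ℝ), 0 < L → ∃ B : ℝ, ∀ y : ℝ, 0 ≤ y →
      ‖(N (c + Complex.exp (-(((2 * π / L : ℝ) : ℂ) * (((L / 2 : ℝ) : ℂ) + (y : ℂ) * I) * I))) - N c) *
        Complex.exp (((2 * π / L : ℝ) : ℂ) * (((L / 2 : ℝ) : ℂ) + (y : ℂ) * I) * I)‖ ≤ B) ∧
    (∀ c : ℂ, c.im = 4 → ∀ L : ℝ, 0 < L → ∀ M : ℝ, ∃ Y : ℝ, ∀ y : ℝ, Y ≤ y →
      ∃ x : ℝ, x ∈ Set.Ioo 0 (L / 2) ∧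
        M ≤ ‖(N (c + Complex.exp (-(((2 * π / L : ℝ) : ℂ) * ((x : ℂ) + (y : ℂ) * I) * I))) - N c) *
          Complex.exp (((2 * π / L : ℝ) : ℂ) * ((x : ℂ) + (y : ℂ) * I) * I)‖) :=
  ⟨newmanGrowth_zero_ne_one N hN, fun c L hL => newmanGrowth_bounded N hN c L hL,
    fun c hc L hL M => newmanGrowth_large N hN c hc L hL M⟩

end PotentialFlow
end MarginalStabilityChainStretchedVortexRows
end Summit.AnomalousDissipation.AnomalousDissipation.Theorems
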